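import Literature.Barriers.CriticalPhenomena.SupercriticalSAWSpaceFillingTilesAnnulusGeometry
import Literature.Barriers.CriticalPhenomena.SupercriticalSAWSpaceFillingTilesMeasure
import Literature.Probability.RandomPlanarGeometry.SAWSpliceBound
import Literature.Probability.RandomPlanarGeometry.SAWTileFamilies
import HarnessLib

/-!
# Supercritical SAW (Duminil-Copin–Kozma–Yadin 2014), Theorem 6 for the disk via odd tiles:
# the energy–entropy bound of the annular case

The case of the proof of Theorem 6 of H. Duminil-Copin, G. Kozma, A. Yadin, *Supercritical
self-avoiding walks are space-filling*, Ann. IHP Probab. Stat. 50 (2014), §3, that the print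
omits: walks `γ` of `𝔻_δ` from `a_δ` to `b_δ` for which every deep tile is clear (so `γ` stays
in a boundary layer of width `O(L)`). The surgery of `SAWSpliceDefs.lean` is performed about the
origin (tile `t' = 0`, sphere radius `d₀ = dist_{ℓ¹}(0, γ)`, the template of the cover theorem —
the exceptional endpoint configurations being excluded by the rim lemma
`not_bad_of_isClosestSite` — and, as structure, the merged excursions of the half-disk family
`halfFamily δ m r Rd G` below the arena in the lane frame `G`):
`annEvent_bound` —
`G(E_{d₀,G}) · x^{(4r+2)(|F_G|-1)} Z_m(x)^{|F_G|} ≤ 80 (d₀+1) max(1,x⁻¹)^{10 d₀+3} · Z(𝔻_δ,u,v,x)`,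
for the walks (as vertex lists) clearing every deep tile with radius `ρ`, at `ℓ¹`-distance
exactly `d₀` from the origin and whose cover template has lane frame `G`. Since `|F_G| ≍ 1/δ²`
while `d₀ ≤ 2/δ`, this is `e^{-c/δ²}` small (assembled in `…TilesTheorem6.lean`).
-/

noncomputable section

open Finset Literature.Probability.LatticeModels Literature.Probability.Percolation
  Literature.Probability.RandomPlanarGeometry.SAW

namespace Literature.Barriers.CriticalPhenomena

namespace SupercriticalSAW

variable {m r : ℕ} {δ : ℝ} {u v : Site 2}

/-! ### The cover template of a walk about the origin -/

open Classical in
/-- The template of the cover theorem for a walk about the origin at radius `d₀` (a junk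
`TB1` template if none applies). [cite: DuminilCopinKozmaYadin2014, §3 (proof of Proposition 7: the link ℓ(γ))] -/
def coverTemplate (d₀ : ℤ) (l : List (Site 2)) : Template :=
  if h : ∃ T : Template, T.F.z₀ = 0 ∧ T.WF d₀ ∧ T.Holds l then Classical.choose h
  else ⟨Frame.std 0, 0, d₀, .TB1⟩

/-- The cover template is centred at the origin, well formed, and applies whenever some
template does. [folklore] -/
theorem coverTemplate_spec (d₀ : ℤ) (l : List (Site 2)) :
    (coverTemplate d₀ l).F.z₀ = 0 ∧ (coverTemplate d₀ l).WF d₀ ∧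
      ((∃ T : Template, T.F.z₀ = 0 ∧ T.WF d₀ ∧ T.Holds l) → (coverTemplate d₀ l).Holds l) := by
  classical
  by_cases h : ∃ T : Template, T.F.z₀ = 0 ∧ T.WF d₀ ∧ T.Holds l
  · have hs := Classical.choose_spec h
    simp only [coverTemplate, dif_pos h]
    exact ⟨hs.1, hs.2.1, fun _ => hs.2.2⟩
  · simp only [coverTemplate, dif_neg h]
    exact ⟨rfl, ⟨rfl, rfl⟩, fun h' => absurd h' h⟩

/-! ### The annular event -/

open Classical in
/-- **The annular event** (split by the sphere radius and the lane frame): the vertex lists of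
walks of `𝔻_δ` from `u` to `v` clearing every deep tile with radius `ρ`, at `ℓ¹`-distance
exactly `d₀` from the origin, whose cover template has lane frame `G`.
[cite: DuminilCopinKozmaYadin2014, §3 (proof of Theorem 6)] -/
def annEvent (m r : ℕ) (δ : ℝ) (u v : Site 2) (ρ : ℤ) (Rd : ℕ) (d₀ : ℤ) (G : Frame) : Finset (List (Site 2)) :=
  (domSawLists (zdGraph 2) (Dfin δ) u v).filter fun l =>
    (∀ τ ∈ deepTiles δ m r Rd, IsClearTile m r l ρ τ) ∧ (∀ w ∈ l, d₀ ≤ l1dist w 0) ∧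
      (∃ g ∈ l, l1dist g 0 = d₀) ∧ Splice.laneFrame (coverTemplate d₀ l) = G

/-- Membership in the annular event. [folklore] -/
theorem mem_annEvent {ρ : ℤ} {Rd : ℕ} {d₀ : ℤ} {G : Frame} {l : List (Site 2)} :
    l ∈ annEvent m r δ u v ρ Rd d₀ G ↔ l ∈ domSawLists (zdGraph 2) (Dfin δ) u v ∧
      (∀ τ ∈ deepTiles δ m r Rd, IsClearTile m r l ρ τ) ∧ (∀ w ∈ l, d₀ ≤ l1dist w 0) ∧
      (∃ g ∈ l, l1dist g 0 = d₀) ∧ Splice.laneFrame (coverTemplate d₀ l) = G := by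
  classical
  rw [annEvent, Finset.mem_filter]

/-- **A template applies to every walk of the annular event** (endpoints closest sites to
boundary points, `≥ 10` apart, `0 < δ ≤ 1/10`, `d₀ ≥ 3`).
[cite: DuminilCopinKozmaYadin2014, §3 (proof of Proposition 7: existence of the link)] -/
theorem exists_template_of_mem_annEvent (hδ : 0 < δ) (hδ' : δ ≤ 1 / 10) {a b : ℂ} (ha : ‖a‖ = 1) (hb : ‖b‖ = 1)
    (hu : IsClosestSite unitDisk δ a u) (hv : IsClosestSite unitDisk δ b v) (huv : 10 ≤ l1dist u v)
    {ρ : ℤ} {Rd : ℕ} {d₀ : ℤ} (hd : 3 ≤ d₀) {G : Frame} {l : List (Site 2)} (hl : l ∈ annEvent m r δ u v ρ Rd d₀ G) :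
    ∃ T : Template, T.F.z₀ = 0 ∧ T.WF d₀ ∧ T.Holds l := by
  rw [mem_annEvent, mem_domSawLists] at hl
  obtain ⟨⟨hsaw, hhead, hlast⟩, -, hfree, hΓ, -⟩ := hl
  have hlD : ∀ w ∈ l, w ∈ meshDomain unitDisk δ := fun w hw => (mem_Dfin hδ).1 (hsaw.subset w hw)
  rcases exists_template hsaw.nodup hsaw.isChain hhead hlast huv 0 hd hfree hΓ with
    hT | ⟨G', hG', hB⟩ | ⟨G', hG', hB⟩
  · exact hT
  · exact absurd hB (not_bad_of_isClosestSite hδ hδ' ha hb hu hv hhead hlast hlD G' hG' (by omega)).1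
  · exact absurd hB (not_bad_of_isClosestSite hδ hδ' ha hb hu hv hhead hlast hlD G' hG' (by omega)).2

/-! ### The port direction of a frame -/

/-- The lattice direction of `-ey` (the side of the origin tile facing the half-disk family).
[folklore] -/
def dirDown (G : Frame) : Dir := by
  classical
  exact if G.ey = pt 0 1 then .S else if G.ey = pt 0 (-1) then .N else if G.ey = pt 1 0 then .W else .E

/-- `(dirDown G).vec = -ey`. [folklore] -/
theorem dirDown_vec (G : Frame) : (dirDown G).vec = -G.ey := by
  classical
  unfold dirDown
  rcases G.valid with ⟨-, h2 | h2⟩ | ⟨-, h2 | h2⟩ | ⟨-, h2 | h2⟩ | ⟨-, h2 | h2⟩ <;>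
    simp [h2, Dir.vec, neg_pt, site_eq_iff]

/-- The centre of the origin tile is the origin. [folklore] -/
theorem ctr_zero : OddTile.ctr m r 0 = 0 := by
  funext i; simp

/-! ### The bound -/

/-- **The energy–entropy bound of the annular case.** See the module docstring.
[cite: DuminilCopinKozmaYadin2014, §3 (proof of Theorem 6; Proposition 7 and Claim)] -/
theorem annEvent_bound (hδ : 0 < δ) (hδ' : δ ≤ 1 / 10) (hr : 4 ≤ r) {x : ℝ} (hx : 0 < x)
    {ρ : ℤ} {Rd M : ℕ} {d₀ : ℤ} {G : Frame} (hG : G.z₀ = 0) (hM : 1 ≤ M)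
    (hdeepM : ∀ τ : Site 2, (∀ k, |τ k| ≤ M) → IsDeepTile δ m r Rd τ)
    (hbig : 2 * Splice.A m r + 12 ≤ d₀) (hρhw : 2 * (OddTile.hw m r : ℤ) ≤ ρ) (hARd : Splice.A m r + 1 ≤ Rd)
    {a b : ℂ} (ha : ‖a‖ = 1) (hb : ‖b‖ = 1) (hu : IsClosestSite unitDisk δ a u)
    (hv : IsClosestSite unitDisk δ b v) (huv : 10 ≤ l1dist u v) :
    (∑ l ∈ annEvent m r δ u v ρ Rd d₀ G, x ^ (l.length - 1)) *
        (x ^ ((4 * r + 2) * ((halfFamily δ m r Rd G).card - 1)) * Zbox m x ^ (halfFamily δ m r Rd G).card) ≤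
      80 * (d₀ + 1) * max 1 x⁻¹ ^ (10 * d₀ + 3).toNat * listPartition (zdGraph 2) (Dfin δ) u v x := by
  classical
  set F := halfFamily δ m r Rd G with hF
  set dp := dirDown G with hdp
  set t : Site 2 := -G.ey with htdef
  have ht0 : (0 : Site 2) + dp.vec = t := by rw [hdp, dirDown_vec, zero_add]
  have ht'eq : (0 : Site 2) = t + dp.neg.vec := by rw [Dir.vec_neg, hdp, dirDown_vec, htdef]; abel
  have hA : Splice.A m r = OddTile.hw m r + r := rfl
  have hd3 : 3 ≤ d₀ := by rw [hA] at hbig; omega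
  have hd6 : 6 ≤ d₀ := by rw [hA] at hbig; omega
  have hhw := OddTile.hw_eq (m := m) (r := r)
  have hside := OddTile.side_eq (m := m) (r := r)
  -- the family
  have htF : t ∈ F := neg_ey_mem_halfFamily hδ hM G hG hdeepM
  have h0F : (0 : Site 2) ∉ F := zero_not_mem_halfFamily hδ hG
  have hFconn : IsGraphConnected (zdGraph 2) F := isGraphConnected_halfFamily hδ G hG htF
  have hFdeep : ∀ τ ∈ F, IsDeepTile δ m r Rd τ := fun τ hτ => ((mem_halfFamily hδ).1 hτ).1
  -- the attachment sequence of `F` rooted at `t`, avoiding `0`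
  obtain ⟨steps, hvalid, hnd, htiles, hlen⟩ := OddTile.exists_validFrom hFconn htF h0F
  have hvalid' : OddTile.ValidFrom (t + dp.neg.vec) [t] steps := ht'eq ▸ hvalid
  -- the structures
  let ext : (∀ τ ∈ F, Finset (Sym2 (Site 2))) → List (Site 2) :=
    fun c => OddTile.mergeList m r (OddTile.toAssign F c) t dp.neg steps
  have hext : Set.InjOn ext (OddTile.configs m r F) := OddTile.mergeList_toAssign_injOn hvalid ht'eq htiles
  have hmemT : ∀ τ ∈ OddTile.tilesAfter [t] steps, τ ∈ F := fun τ hτ => by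
    rw [← htiles, List.mem_toFinset]; exact hτ
  have hI : ∀ c ∈ OddTile.configs m r F, OddTile.MergeInv m r (OddTile.toAssign F c) t dp.neg
      (OddTile.entries t dp.neg steps) steps (ext c) := fun c hc =>
    OddTile.MergeInv.mergeList hvalid' (OddTile.toAssign_mem_tilePolygons hc htF) fun q hq =>
      OddTile.toAssign_mem_tilePolygons hc (hmemT _ (by
        rw [OddTile.tilesAfter]; exact List.mem_append_right _ (List.mem_map_of_mem hq)))
  -- the templates (opaque)
  obtain ⟨Tf, hTfdef⟩ : ∃ Tf : List (Site 2) → Template, Tf = coverTemplate d₀ := ⟨_, rfl⟩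
  have hTf : ∀ l, (Tf l).F.z₀ = 0 ∧ (Tf l).WF d₀ ∧
      (l ∈ annEvent m r δ u v ρ Rd d₀ G → (Tf l).Holds l ∧ Splice.laneFrame (Tf l) = G) := by
    intro l
    have hs := coverTemplate_spec d₀ l
    rw [hTfdef]
    refine ⟨hs.1, hs.2.1, fun hl => ⟨hs.2.2 (exists_template_of_mem_annEvent hδ hδ' ha hb hu hv huv hd3 hl), ?_⟩⟩
    exact ((mem_annEvent.1 hl).2.2.2.2)
  have hTz : ∀ l, (Tf l).F.z₀ = OddTile.ctr m r 0 := fun l => by rw [ctr_zero]; exact (hTf l).1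
  -- the splice data
  let Xf : List (Site 2) → (∀ τ ∈ F, Finset (Sym2 (Site 2))) → Splice.Data m r := fun l c =>
    ⟨Tf l, 0, dp, ext c, d₀, (hTf l).2.1, hTz l, hbig⟩
  -- the splice hypotheses
  have hHyp : ∀ l ∈ annEvent m r δ u v ρ Rd d₀ G, ∀ c ∈ OddTile.configs m r F, (Xf l c).Hyp (Dfin δ) u v l := by
    intro l hl c hc
    have hl' := hl
    rw [mem_annEvent] at hl'
    obtain ⟨hmem, hclear, hfree, hΓ, -⟩ := hl'
    obtain ⟨hholds, hlane⟩ := (hTf l).2.2 hl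
    have hz : (Tf l).F.z₀ = 0 := (hTf l).1
    have hIc := hI c hc
    have hlD : ∀ w ∈ l, w ∈ meshDomain unitDisk δ := fun w hw =>
      (mem_Dfin hδ).1 ((mem_domSawLists.1 hmem).1.subset w hw)
    -- vertices of the structure lie in tiles of `F`
    have hSτ : ∀ w ∈ ext c, ∃ τ ∈ F, w ∈ OddTile.tile m r τ := fun w hw => by
      obtain ⟨τ, hτ, hwτ⟩ := hIc.exists_mem_tile hw
      rw [OddTile.map_fst_entries] at hτ
      exact ⟨τ, hmemT τ hτ, hwτ⟩
    have hRdhw : (OddTile.hw m r : ℤ) ≤ Rd := by rw [hA] at hARd; omega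
    refine ⟨hmem, hholds, fun w hw => ?_, hIc.saw.isChain, hIc.saw.nodup, ?_, ?_, ?_, ?_, ?_, ?_, ?_, ?_⟩
    · -- the ball is free
      show d₀ ≤ l1dist w (Tf l).F.z₀
      rw [hz]; exact hfree w hw
    · show (ext c).head? = some (OddTile.portA m r (0 + dp.vec) dp.neg)
      rw [ht0]; exact hIc.head
    · show (ext c).getLast? = some (OddTile.portB m r (0 + dp.vec) dp.neg)
      rw [ht0]; exact hIc.last
    · -- inside the domain
      intro w hw
      obtain ⟨τ, hτ, hwτ⟩ := hSτ w hw
      exact (mem_Dfin hδ).2 ((hFdeep τ hτ).tile_subset (by exact_mod_cast hRdhw) hwτ)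
    · -- off the walk: tiles of `F` are deep, hence clear
      intro w hw
      obtain ⟨τ, hτ, hwτ⟩ := hSτ w hw
      exact (hclear τ ((mem_deepTiles hδ).2 (hFdeep τ hτ))).not_mem hρhw hwτ
    · -- off the arena
      intro w hw
      refine hIc.not_mem_arena (τ₀ := 0) ?_ hw
      rw [OddTile.map_fst_entries]
      exact fun h => h0F (hmemT _ h)
    · -- off the lanes and the tail: those have non-negative lane ordinate, the structure negative
      intro w hw hwp
      obtain ⟨τ, hτ, hwτ⟩ := hSτ w hw
      have h1 := fy_le_of_mem_tile_halfFamily hδ hG hτ hwτ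
      have h2 := LaneFacts.fy_nonneg_of_mem_pathSites (Xf l c) hwp
      have hlane' : Splice.laneFrame (Xf l c).T = G := hlane
      rw [hlane'] at h2
      omega
    · -- the domain contains the lanes and the tail
      intro w hw
      rw [(Xf l c).mem_pathSites] at hw
      rcases hw with hw | hw | hw
      · exact (mem_Dfin hδ).2 (LaneFacts.mem_meshDomain_of_mem_lanes (Xf l c) hd6 hz (Or.inl hw)
          (hlD _ ((Tf l).g_mem_of_holds hholds)))
      · exact (mem_Dfin hδ).2 (LaneFacts.mem_meshDomain_of_mem_lanes (Xf l c) hd6 hz (Or.inr hw)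
          (hlD _ ((Tf l).g_mem_of_holds hholds)))
      · exact (mem_Dfin hδ).2 (LaneFacts.mem_meshDomain_of_mem_tail (Xf l c) hz hw
          (hlD _ (TemplateFacts.s₂_mem_of_holds (Tf l) hholds)))
    · -- the domain contains the arena (inside the deep origin tile's ball)
      intro w hw
      change w ∈ OddTile.arena m r 0 at hw
      rw [OddTile.mem_arena_iff] at hw
      refine (mem_Dfin hδ).2 (hdeepM 0 (fun k => by simp) w fun i => ?_)
      have := hw i
      simp only [Pi.zero_apply, mul_zero, zero_sub, zero_add, OddTile.ctr_apply, sub_zero] at this ⊢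
      rw [hA] at hARd
      rw [abs_le]; constructor <;> omega
  -- the weighted bound
  have key := Splice.weighted_sum_le (m := m) (r := r) (Dfin δ) u v hx 0 dp d₀
    (annEvent m r δ u v ρ Rd d₀ G) Tf (OddTile.configs m r F) ext hext Xf
    (fun l hl c hc => ⟨rfl, rfl, rfl, rfl, rfl, hHyp l hl c hc⟩) (by omega)
  -- the left-hand side factorises
  have hsum : ∀ l : List (Site 2), ∑ c ∈ OddTile.configs m r F, x ^ (l.length - 1 + (ext c).length) =
      x ^ (l.length - 1) * (x ^ ((4 * r + 2) * (F.card - 1)) * Zbox m x ^ F.card) := by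
    intro l
    rw [← OddTile.sum_configs_pow_length (m := m) (r := r) hvalid ht'eq hnd htiles x, Finset.mul_sum]
    refine Finset.sum_congr rfl fun c _ => ?_
    rw [pow_add]
  simp only [hsum] at key
  rw [← Finset.sum_mul] at key
  exact key

end SupercriticalSAW

end Literature.Barriers.CriticalPhenomena
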